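import Summits.NavierStokesRegularity.NavierStokesRegularity.Theorems.ProductionEfficiencyDecay.Negative.ProductionEfficiencyDecayFalseOfDssLerayHopfBlowup
import HarnessLib

/-!
# `EfficiencyFloor.ProductionEfficiencyDecay` (stmt-NavierStokesRegularity-22866) is false as soon as ONE
# Leray-rate (enstrophy-Type-I) blow-up exists — negative lemma modulo `LerayRateBlowup`

`--supports stmt-NavierStokesRegularity-22866`, lane `--negative-modulo LerayRateBlowup`. This is the route's own
KILL CRITERION ("refuted outright by ONE maximal solution whose enstrophy obeys `Z(t) ≤ K(T−t)^{−1/2}`"),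
kernel-checked: the weakest object refuting the crux.

THE HYPOTHESIS `LerayRateBlowup` (NOT constructible in the tree): some maximal smooth solution of unforced
Navier–Stokes on `ℝ³ × [0,T)`, Leray–Hopf from its rapidly decaying datum, has enstrophy at most Leray's rate,
`∫|curl u(t)|² ≤ K/√(T−t)` on `[0,T)` for some `K` — i.e. ONE maximal solution satisfying the conclusion of the
route's residual `EnstrophyQuarterLaw` (stmt-1574). An inhabitant is a finite-time singularity from Schwartz data;
every exactly-DSS blow-up (`DssLerayHopfBlowup`) is expected to be of this kind.

THE THEOREM `ProductionEfficiencyDecay_false_of_LerayRateBlowup`: the crux's ε-laws plus the landed supports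
`BlowupEnstrophyUnbounded` (stmt-22867) / `FloorOfEfficiencyDecay` (stmt-22868) give the super-Leray floor
`(K+1)/√(T−t) < Z(t)` eventually (`floor_eventually_of_window_law`), against `Z(t) ≤ K/√(T−t)`.
Equivalently (the pincer read backwards): `ProductionEfficiencyDecay ∧ EnstrophyQuarterLaw` forces the class of
maximal solutions to be empty — which is how the route's Assembly closes.

HONEST FRAMING: conditional on a non-constructible object; NOT a refutation of stmt-22866; nothing about NS
regularity is asserted. [folklore]
-/

-- the problem directory repeats the summit name (`NavierStokesRegularity/NavierStokesRegularity`)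
set_option linter.dupNamespace false

noncomputable section

open Set Filter MeasureTheory Topology
open scoped ENNReal NNReal
open Literature.Analysis.FluidPDE

namespace Summit.NavierStokesRegularity.NavierStokesRegularity.Theorems

namespace ProductionEfficiencyDecayNegative

/-- **Hypothesis `LerayRateBlowup` (NOT constructible in the tree; filed `--negative-modulo`).** Some maximal smooth
Leray–Hopf rapidly-decaying-datum solution on `ℝ³ × [0,T)` (`ν, T > 0`) has enstrophy at most Leray's rate:
`∫⁻|curl u(t)|² ≤ ofReal (K/√(T−t))` for all `t ∈ [0,T)`, for some `K` (the conclusion of the route's residual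
`EnstrophyQuarterLaw` for THIS solution). An inhabitant is in particular a finite-time singularity from Schwartz
data. -/
def LerayRateBlowup : Prop :=
  ∃ (ν T : ℝ) (u : ℝ → EuclideanSpace ℝ (Fin 3) → EuclideanSpace ℝ (Fin 3))
    (p : ℝ → EuclideanSpace ℝ (Fin 3) → ℝ), 0 < ν ∧ 0 < T ∧
    Literature.Analysis.FluidPDE.IsMaximalSmoothSolution ν 0 u p T ∧
    Literature.Analysis.FluidPDE.IsLerayHopfOn T ν 0 (u 0) u ∧
    Literature.Analysis.FluidPDE.HasRapidSpatialDecay (u 0) ∧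
    ∃ K : ℝ, ∀ t ∈ Set.Ico 0 T,
      ∫⁻ x, ‖Literature.Analysis.FluidPDE.curl (u t) x‖ₑ ^ 2 ≤ ENNReal.ofReal (K / Real.sqrt (T - t))

/-- **`ProductionEfficiencyDecay` is false modulo `LerayRateBlowup`** (the route's kill criterion): along a
Leray-rate blow-up the crux's ε-laws would give the super-Leray floor `(K+1)/√(T−t) < Z(t) ≤ K/√(T−t)`
eventually — absurd. Conditional on a non-constructible object: NOT a refutation of the item. [folklore] -/
theorem ProductionEfficiencyDecay_false_of_LerayRateBlowup (hH : LerayRateBlowup) :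
    ¬ Summit.NavierStokesRegularity.NavierStokesRegularity.Theses.EfficiencyFloor.ProductionEfficiencyDecay := by
  intro hE
  obtain ⟨ν, T, u, p, hν, hT, hmax, hLH, hdec, K, hK⟩ := hH
  have hF := floor_eventually_of_window_law hν hT hmax hLH hdec (hE ν T hν hT u p hmax hLH hdec) (K + 1)
  have hIco : ∀ᶠ t in 𝓝[<] T, t ∈ Ico 0 T := Ico_mem_nhdsLT hT
  obtain ⟨t, hfloor, htI⟩ := (hF.and hIco).exists
  have hs : 0 < Real.sqrt (T - t) := Real.sqrt_pos.2 (sub_pos.2 htI.2)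
  have hle : ENNReal.ofReal (K / Real.sqrt (T - t)) ≤ ENNReal.ofReal ((K + 1) / Real.sqrt (T - t)) :=
    ENNReal.ofReal_le_ofReal (div_le_div_of_nonneg_right (by linarith) hs.le)
  exact lt_irrefl _ ((hfloor.trans_le (hK t htI)).trans_le hle)

end ProductionEfficiencyDecayNegative

end Summit.NavierStokesRegularity.NavierStokesRegularity.Theorems

end
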